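import Literature.AlgebraicGeometry.GroupSchemes.AffineGroupSchemeBaseChangeHopf
import Literature.AlgebraicGeometry.GroupSchemes.AffineGroupSchemeBialgHom
import HarnessLib

/-!
# `Γ(G_{R′}) ≅ R′ ⊗_R Γ(G)` is natural in the affine group scheme `G`

Layer `Literature/AlgebraicGeometry/GroupSchemes`, namespace `Literature.AlgebraicGeometry.GroupSchemes.AffineGroupScheme` (continues ★
`AffineGroupSchemeBaseChangePoints` — `baseChangePtMulEquiv`, `algHomEquivBaseChange` (Yoneda) —, ★ `AffineGroupSchemeBaseChangeAlg` p845472 —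
`toAlgBaseChange`, `algBaseChangeEquiv R′ G : Alg G_{R′} ≃ₐ[R′] R′ ⊗[R] Alg G` — and ★ `AffineGroupSchemeBaseChangeHopf` p845509 — `algHom_ext_toAlgBaseChange`).
THEOREMS ONLY (no definition, no instance, no notation, no named fact, no `sorry`).  Cell `hodgecm-mathlib` (D-0151), programme P6 «MOD», organ (N2a-i)
of B-p04 (g37): the algebra half of the naturality of `(G^D)_{R′} ≅ (G_{R′})^D` in `G` ((N2), for the base change of `H^⊥`).  Count-neutral
Mathlib-side capital: HC_CM is proved only modulo the printed citations until rung 0 closes; nothing here bears on it.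

THE PRINT ([GortzWedhorn2020] (4.7.1), (4.15) p. 116: base change is a functor; [GortzWedhorn2023] §(27.2): `Γ(G ×_R R′) = Γ(G) ⊗_R R′` functorially).
For a morphism `g : G₁ ⟶ G₂` of affine group objects of `SchemeOver R` (no `IsMonHom` needed) and its base change
`g_{R′} := (Over.pullback (Spec R′ → Spec R)).map g : (G₁)_{R′} ⟶ (G₂)_{R′}`:

* §1 `baseChangePtMulEquiv_comp_pullback_map : (u ≫ g_{R′})♭ = u♭ ≫ g` (Mathlib `Adjunction.homEquiv_naturality_right_symm`);
* §2 `algHomEquivBaseChange_comp_comap_pullback_map : algHomEquivBaseChange (φ ∘ Γ(g_{R′})) = algHomEquivBaseChange φ ∘ Γ(g)` (★ `ptEquiv_comp` twice);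
* §3 **`comap_pullback_map_comp_toAlgBaseChange : Γ(g_{R′}) ∘ (Γ(G₂) → Γ((G₂)_{R′})) = (Γ(G₁) → Γ((G₁)_{R′})) ∘ Γ(g)`** — the universal maps
  ★ `toAlgBaseChange` are natural;
* §4 HEAD **`algBaseChangeEquiv_comap_pullback_map : e_{G₁} (Γ(g_{R′}) y) = (R′ ⊗ Γ(g)) (e_{G₂} y)`** (`e_G :=` ★ `algBaseChangeEquiv R′ G`; by ★
  `algHom_ext_toAlgBaseChange` on the generators `1 ⊗ a`), with the composite ∕ inverse forms `toAlgHom_algBaseChangeEquiv_comp_comap_pullback_map`,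
  `algBaseChangeEquiv_symm_map_comap`.

## References
* [GortzWedhorn2020] U. Görtz, T. Wedhorn, *Algebraic Geometry I: Schemes*, 2nd ed. (2020), (4.7.1) (p. 108), (4.15) and Definition 4.42 (p. 116).
* [GortzWedhorn2023] U. Görtz, T. Wedhorn, *Algebraic Geometry II* (2023), §(27.2) (pp. 606–607).
-/

set_option autoImplicit false

-- Mathlib's `Over`/`Scheme` APIs are stated across semireducible wrappers (as in the ★ `GroupSchemes/*` files).
set_option backward.isDefEq.respectTransparency false

universe u

open CategoryTheory CategoryTheory.Limits AlgebraicGeometry MonoidalCategory CartesianMonoidalCategory TensorProduct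

noncomputable section

namespace Literature.AlgebraicGeometry.GroupSchemes

namespace AffineGroupScheme

open scoped MonObj CategoryTheory.Obj

open Literature.AlgebraicGeometry.Motives Literature.NumberTheory.DiophantineGeometry

variable {R : Type u} [CommRing R] (R' : Type u) [CommRing R'] [Algebra R R'] {G₁ G₂ : SchemeOver R} [GrpObj G₁] [GrpObj G₂] (g : G₁ ⟶ G₂)

/-! ## §1 Points: `(u ≫ g_{R′})♭ = u♭ ≫ g` -/

section Points

variable (R'' : Type u) [CommRing R''] [Algebra R R''] [Algebra R' R''] [IsScalarTower R R' R'']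

/-- **`baseChangePtMulEquiv` is natural in `G`**: the `R″`-point `u ≫ g_{R′}` of `(G₂)_{R′}` corresponds to the point `u♭ ≫ g` of `G₂`
(Mathlib `Adjunction.homEquiv_naturality_right_symm` for `Over.map ⊣ Over.pullback`). [cite: GortzWedhorn2020, (4.15) and Definition 4.42, p. 116] -/
theorem baseChangePtMulEquiv_comp_pullback_map
    (u : specOver R' R'' ⟶ (Over.pullback (Spec.map (CommRingCat.ofHom (algebraMap R R')))).obj G₁) :
    baseChangePtMulEquiv R' R'' G₂ (u ≫ (Over.pullback (Spec.map (CommRingCat.ofHom (algebraMap R R')))).map g) =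
      baseChangePtMulEquiv R' R'' G₁ u ≫ g := by
  change (mapSpecOverIso R' R'').inv ≫ ((Over.mapPullbackAdj _).homEquiv _ _).symm (u ≫ (Over.pullback _).map g) =
    ((mapSpecOverIso R' R'').inv ≫ ((Over.mapPullbackAdj _).homEquiv _ _).symm u) ≫ g
  rw [Adjunction.homEquiv_naturality_right_symm, Category.assoc]

end Points

/-! ## §2 Algebra maps: `algHomEquivBaseChange (φ ∘ Γ(g_{R′})) = algHomEquivBaseChange φ ∘ Γ(g)` -/

section Alg

variable [IsAffine G₁.left] [IsAffine G₂.left]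
  [IsAffine ((Over.pullback (Spec.map (CommRingCat.ofHom (algebraMap R R')))).obj G₁).left]
  [IsAffine ((Over.pullback (Spec.map (CommRingCat.ofHom (algebraMap R R')))).obj G₂).left]

/-- **`algHomEquivBaseChange` is natural in `G`** (★ `ptEquiv_comp` on both sides of §1). [cite: GortzWedhorn2023, §(27.2) (pp. 606–607)] -/
theorem algHomEquivBaseChange_comp_comap_pullback_map {R'' : Type u} [CommRing R''] [Algebra R R''] [Algebra R' R''] [IsScalarTower R R' R'']
    (φ : Alg ((Over.pullback (Spec.map (CommRingCat.ofHom (algebraMap R R')))).obj G₁) →ₐ[R'] R'') :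
    algHomEquivBaseChange R' R'' G₂ (φ.comp (Alg.comap ((Over.pullback (Spec.map (CommRingCat.ofHom (algebraMap R R')))).map g))) =
      (algHomEquivBaseChange R' R'' G₁ φ).comp (Alg.comap g) := by
  obtain ⟨u, rfl⟩ := (ptEquiv ((Over.pullback (Spec.map (CommRingCat.ofHom (algebraMap R R')))).obj G₁) R'').surjective φ
  rw [algHomEquivBaseChange_apply, algHomEquivBaseChange_apply, Equiv.symm_apply_apply, ← ptEquiv_comp, Equiv.symm_apply_apply,
    baseChangePtMulEquiv_comp_pullback_map, ptEquiv_comp]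

/-! ## §3 The universal maps `Γ(G) → Γ(G_{R′})` are natural -/

/-- **`Γ(g_{R′}) ∘ (Γ(G₂) → Γ((G₂)_{R′})) = (Γ(G₁) → Γ((G₁)_{R′})) ∘ Γ(g)`** (★ `toAlgBaseChange` = the image of `id` under the Yoneda bijection,
§2 at `φ = id` and ★ `algHomEquivBaseChange_eq`). [cite: GortzWedhorn2020, Section (4.7), (4.7.1) (p. 108)] -/
theorem comap_pullback_map_comp_toAlgBaseChange :
    ((Alg.comap ((Over.pullback (Spec.map (CommRingCat.ofHom (algebraMap R R')))).map g)).restrictScalars R).comp (toAlgBaseChange R' G₂) =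
      (toAlgBaseChange R' G₁).comp (Alg.comap g) := by
  have h := algHomEquivBaseChange_comp_comap_pullback_map R' g
    (AlgHom.id R' (Alg ((Over.pullback (Spec.map (CommRingCat.ofHom (algebraMap R R')))).obj G₁)))
  rw [AlgHom.id_comp, algHomEquivBaseChange_eq] at h
  rw [h]
  rfl

/-- The same on elements: `Γ(g_{R′}) (ι₂ a) = ι₁ (Γ(g) a)`. [cite: GortzWedhorn2020, Section (4.7), (4.7.1) (p. 108)] -/
theorem comap_pullback_map_toAlgBaseChange (a : Alg G₂) :
    Alg.comap ((Over.pullback (Spec.map (CommRingCat.ofHom (algebraMap R R')))).map g) (toAlgBaseChange R' G₂ a) =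
      toAlgBaseChange R' G₁ (Alg.comap g a) :=
  AlgHom.congr_fun (comap_pullback_map_comp_toAlgBaseChange R' g) a

/-! ## §4 HEAD: `Γ(G_{R′}) ≅ R′ ⊗ Γ(G)` is natural in `G` -/

/-- **HEAD — `e_{G₁} ∘ Γ(g_{R′}) = (R′ ⊗ Γ(g)) ∘ e_{G₂}`** as `R′`-algebra maps `Γ((G₂)_{R′}) → R′ ⊗ Γ(G₁)` (`e_G :=` ★ `algBaseChangeEquiv R′ G`): both
agree on the generators `ι₂ a ↦ 1 ⊗ Γ(g)(a)` (★ `algHom_ext_toAlgBaseChange`, §3, ★ `algBaseChangeEquiv_toAlgBaseChange`).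
[cite: GortzWedhorn2023, §(27.2) (pp. 606–607)] [cite: GortzWedhorn2020, (4.15), p. 116] -/
theorem toAlgHom_algBaseChangeEquiv_comp_comap_pullback_map :
    (algBaseChangeEquiv R' G₁).toAlgHom.comp (Alg.comap ((Over.pullback (Spec.map (CommRingCat.ofHom (algebraMap R R')))).map g)) =
      (Algebra.TensorProduct.map (AlgHom.id R' R') (Alg.comap g)).comp (algBaseChangeEquiv R' G₂).toAlgHom := by
  apply algHom_ext_toAlgBaseChange
  apply AlgHom.ext
  intro a
  change algBaseChangeEquiv R' G₁ (Alg.comap ((Over.pullback (Spec.map (CommRingCat.ofHom (algebraMap R R')))).map g) (toAlgBaseChange R' G₂ a)) =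
    Algebra.TensorProduct.map (AlgHom.id R' R') (Alg.comap g) (algBaseChangeEquiv R' G₂ (toAlgBaseChange R' G₂ a))
  rw [comap_pullback_map_toAlgBaseChange, algBaseChangeEquiv_toAlgBaseChange, algBaseChangeEquiv_toAlgBaseChange, Algebra.TensorProduct.map_tmul]
  rfl

/-- On elements: `e_{G₁} (Γ(g_{R′}) y) = (R′ ⊗ Γ(g)) (e_{G₂} y)`. [cite: GortzWedhorn2023, §(27.2) (pp. 606–607)] -/
theorem algBaseChangeEquiv_comap_pullback_map (y : Alg ((Over.pullback (Spec.map (CommRingCat.ofHom (algebraMap R R')))).obj G₂)) :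
    algBaseChangeEquiv R' G₁ (Alg.comap ((Over.pullback (Spec.map (CommRingCat.ofHom (algebraMap R R')))).map g) y) =
      Algebra.TensorProduct.map (AlgHom.id R' R') (Alg.comap g) (algBaseChangeEquiv R' G₂ y) :=
  AlgHom.congr_fun (toAlgHom_algBaseChangeEquiv_comp_comap_pullback_map R' g) y

/-- Inverse form: `e_{G₁}⁻¹ ((R′ ⊗ Γ(g)) z) = Γ(g_{R′}) (e_{G₂}⁻¹ z)`. [cite: GortzWedhorn2023, §(27.2) (pp. 606–607)] -/
theorem algBaseChangeEquiv_symm_map_comap (z : R' ⊗[R] Alg G₂) :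
    (algBaseChangeEquiv R' G₁).symm (Algebra.TensorProduct.map (AlgHom.id R' R') (Alg.comap g) z) =
      Alg.comap ((Over.pullback (Spec.map (CommRingCat.ofHom (algebraMap R R')))).map g) ((algBaseChangeEquiv R' G₂).symm z) := by
  rw [AlgEquiv.symm_apply_eq, algBaseChangeEquiv_comap_pullback_map, AlgEquiv.apply_symm_apply]

end Alg

end AffineGroupScheme

end Literature.AlgebraicGeometry.GroupSchemes

end
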